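import Literature.AnabelianGeometry.EtaleTheta.Cyclotome
import Summits.ABC.IUTFork.LanaLocalUnits
import HarnessLib

/-!
# L-LANA objects X: the cyclotomes `Λ(O^×_v)`, the `Ẑ^×`-symmetry, and cyclotomic rigidity as an interface (LANA §0.4 (f), §4.2 (b), §6.3)

Record-only file (D-0012) of the abc-iut cell (seat abc-iut-c312-4, L-LANA level, plan/LLANA-SPEC N2 as
CONSUMED from seat abc-iut-L2-t3's `Literature/AnabelianGeometry/EtaleTheta/Cyclotome.lean`, and the §6.3
interface of N14 Step 4); TAKES NO SIDE on [IUTchIII] Cor. 3.12. From Project LANA's interim report (bib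
`LANA2026Report`, read on the page):

* §4.2 (b) p. 25: among the objects reconstructed from `G_v` is "The cyclotome (cf. §0.4 (f))
  `Λ(O^×_v) := lim_n (O^×_v)^{gp}[n]`" — `unitCyclotome w := cyclotome (O^×)` for the reference datum of
  `LanaLocalUnits.lean` (a DEFINITION: L2-t3's `cyclotome` of the commutative group `O^× = unitGrp w` with
  its `G`-action `cyclotome.instMulDistribMulAction`).
* §0.4 (f) p. 8: "every cyclotome admits a faithful action of the topological group `Ẑ^×`, which acts on
  the topological group portion trivially and, moreover, on the topological module portion by
  multiplication" and §6.3 pp. 36–37: "without this rigidity … what is determined is not the Θ-value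
  itself, but only its `Ẑ^×`-power orbit" — at the level of L2-t3's discrete model the power maps
  `ζ ↦ ζ^m` (`m ∈ ℤ`, Mathlib `zpowGroupHom`; the units of `Ẑ` act through their residues, not developed
  here) are `G`-EQUIVARIANT (`zpowGroupHom_smul`), i.e. symmetries invisible to the `G`-structure: the typed
  reason an extra RIGIDITY datum is needed.
* §6.3 (6-5) p. 37: "from `G` as well, the cyclotome `Λ(G) := Λ(M(G))` is reconstructed … Cyclotomic
  rigidity is the canonical isomorphism between these two cyclotomes `ι_{G↷M} : Λ(M) ⥲ Λ(G)`", and (6-2)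
  p. 35 "`Θ-Λ-rgd : Λ^{ext}_{Θ,v} ⥲ (l·Δ_Θ)(Π_v)`" — INTERFACE `LocalCyclotomicRigidity G M ΛG`: for a `G`-side
  cyclotome `ΛG` SUPPLIED AS A PARAMETER (reconstructed from `G` alone: [AbsTopIII]/[EtTh] mono-anabelian
  content, seats abc-iut-L4-t1 / L2-t2 — so the structure is a genuine constraint once `ΛG` is that object,
  review of p404411), a `G`-equivariant isomorphism `cyclotome M ⥲ ΛG`; two rigidity isomorphisms onto the
  same `ΛG` differ by a `G`-equivariant automorphism of `Λ(M)` (`discrepancy`, `discrepancy_smul`) — "the"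
  indeterminacy a rigidity result must kill.

[cite: LANA2026Report, §0.4 (f) p. 8, §4.2 (b) p. 25, §6.3 pp. 36–37] NOT here: profinite topology on `Λ`,
`Ẑ^×` itself, Kummer classes (L2-t3's `KummerClass.lean`; used in `LanaKummer.lean`), any judgement.
-/

namespace Summit.ABC
namespace IUTFork

open Literature.AnabelianGeometry.EtaleTheta

/-! ## 1. `Λ(O^×_v)` for the reference datum -/

section UnitCyclotome

variable {K : Type} [Field K] {Γ₀ : Type} [LinearOrderedCommGroupWithZero Γ₀] (w : Valuation K Γ₀)

/-- **§4.2 (b)**: "The cyclotome (cf. §0.4 (f)) `Λ(O^×_v) := lim_n (O^×_v)^{gp}[n]`" — L2-t3's `cyclotome` of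
the unit group `O^×` of `LanaLocalUnits`. [cite: LANA2026Report, §4.2 (b) p. 25] -/
abbrev unitCyclotome : Subgroup (ℕ+ → unitGrp w) := cyclotome (unitGrp w)

variable (G : Type) [Group G] [MulSemiringAction G K] [IsValPreserving w G]

/-- `G_v` acts on `Λ(O^×_v)` ("with the natural continuous actions of `G_v`", §4.2 (b)): the instance is
L2-t3's componentwise action. [cite: LANA2026Report, §4.2 (b) p. 25] -/
example : MulDistribMulAction G (unitCyclotome w) := inferInstance

end UnitCyclotome

/-! ## 2. The power maps: `G`-equivariant symmetries of any cyclotome (§0.4 (f), §6.3) -/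

section Powers

variable {A : Type} [CommGroup A] {G : Type} [Group G] [MulDistribMulAction G A]

/-- The power maps `ζ ↦ ζ^m` (Mathlib `zpowGroupHom m`) commute with the `G`-action on `Λ(A)` — the
"multiplication" symmetries of §0.4 (f) / the `Ẑ^×`-indeterminacy of §6.3 are invisible to the
`G`-module structure (Mathlib `smul_zpow'`, recorded in the source's reading). [cite: LANA2026Report, §6.3 pp. 36–37] -/
theorem zpowGroupHom_smul (m : ℤ) (g : G) (ζ : cyclotome A) :
    zpowGroupHom m (g • ζ) = g • zpowGroupHom m ζ :=
  (smul_zpow' g ζ m).symm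

end Powers

/-! ## 3. Cyclotomic rigidity as an interface (§6.3 (6-5); Step 4 (6-2)) -/

/-- **INTERFACE, §6.3 (6-5)**: for a datum `G ↷ M` (commutative group `M` — in the report `M = O^▷_{k̄}`,
whose groupification carries the torsion) and a `G`-cyclotome `ΛG` reconstructed FROM `G` ALONE ("from `G`
as well, the cyclotome `Λ(G) := Λ(M(G))` is reconstructed", §6.3 p. 37; supplied as a PARAMETER by the
`G`-side reconstruction, [AbsTopIII] Prop. 1.2-type content, seat abc-iut-L4-t1), "the canonical isomorphism
between these two cyclotomes `ι_{G↷M} : Λ(M) ⥲ Λ(G)`". The field `ι_smul` (`G`-equivariance) is only the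
inner-automorphism shadow of the printed "natural with respect to isomorphisms of `G ↷ M`". The Θ-version
(6-2) "`Θ-Λ-rgd : Λ^{ext}_{Θ,v} ⥲ (l·Δ_Θ)(Π_v)`" has the same shape ([EtTh] Cor. 2.19, seat abc-iut-L2-t2).
Named `Local…` to keep clear of the mono-theta object of [IUTchII]. HYPOTHESIS DATA, not a construction.
[cite: LANA2026Report, §6.3 (6-5) p. 37] -/
structure LocalCyclotomicRigidity (G M ΛG : Type) [Group G] [CommGroup M] [MulDistribMulAction G M]
    [CommGroup ΛG] [MulDistribMulAction G ΛG] : Type where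
  /-- `ι_{G↷M} : Λ(M) ⥲ Λ(G)` -/
  ι : cyclotome M ≃* ΛG
  /-- `G`-equivariance -/
  ι_smul : ∀ (g : G) (ζ : cyclotome M), ι (g • ζ) = g • ι ζ

namespace LocalCyclotomicRigidity

variable {G M ΛG : Type} [Group G] [CommGroup M] [MulDistribMulAction G M] [CommGroup ΛG]
  [MulDistribMulAction G ΛG]

/-- Two rigidity isomorphisms onto the SAME `Λ(G)` differ by an automorphism of `Λ(M)` (e.g. a power map
`zpowGroupHom u`, `u ∈ Ẑ^×` — §6.3's indeterminacy "up to `Ẑ^×`" is of this shape).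
[cite: LANA2026Report, §6.3 p. 37] -/
def discrepancy (R R' : LocalCyclotomicRigidity G M ΛG) : cyclotome M ≃* cyclotome M :=
  R.ι.trans R'.ι.symm

/-- … and that automorphism is `G`-equivariant. [cite: LANA2026Report, §6.3 p. 37] -/
theorem discrepancy_smul (R R' : LocalCyclotomicRigidity G M ΛG) (g : G) (ζ : cyclotome M) :
    discrepancy R R' (g • ζ) = g • discrepancy R R' ζ := by
  rw [discrepancy, MulEquiv.trans_apply, R.ι_smul, MulEquiv.trans_apply]
  apply R'.ι.injective
  rw [MulEquiv.apply_symm_apply, R'.ι_smul, MulEquiv.apply_symm_apply]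

/-- The discrepancy of a rigidity isomorphism with itself is the identity. [folklore] -/
theorem discrepancy_self (R : LocalCyclotomicRigidity G M ΛG) (ζ : cyclotome M) : discrepancy R R ζ = ζ := by
  rw [discrepancy, MulEquiv.trans_apply, MulEquiv.symm_apply_apply]

end LocalCyclotomicRigidity

end IUTFork

end Summit.ABC
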